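import Literature.Combinatorics.SimpleGraph.GraphAutomorphismsOneForms
import Literature.Combinatorics.SimpleGraph.FlowLatticeDual
import HarnessLib

/-!
# `Aut(G)` embeds in `GL(g, ℤ)` (Baker–Norine 2009, Corollary 38)

Source (held, read at the page; statements VERBATIM). M. Baker, S. Norine, *Harmonic morphisms
and hyperelliptic graphs*, Int. Math. Res. Not. IMRN 2009 [BakerNorine2009] (held text
`paper:arxiv-0707.1309`, chunk p0015), §4.3: «As a consequence of Proposition 36, we obtain the
following non-trivial restriction on the automorphism group of a 2-edge-connected graph of genus
at least 2: **Corollary 38.** If `G` is a 2-edge-connected graph of genus `g ≥ 2`, then the group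
`Aut(G)` is isomorphic to a subgroup of the group `GL(g, ℤ)` of invertible `g × g` matrices with
coefficients in `ℤ`. *Proof.* Since `Aut(G)` acts faithfully on the `g`-dimensional vector space
`H¹(G, ℝ)` and preserves the lattice `H¹(G, ℤ)`, the result follows.» The integral structure used
here is the fundamental-cycle basis of a spanning tree `T` (Biggs, *Algebraic Graph Theory*,
Theorem 5.2 (1): the `m − n + 1` vectors `ξ_(T,g)` of the chords `g` form a basis of the
cycle-subspace; the tree's `Orientation.fundCycleBasis`, with `ξ_(T,g)(g) = 1` and
`ξ_(T,g)(g′) = 0` for the other chords, so that the coordinates of a flow are its chord values and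
the matrices of the `α^*` are integral).

## What is formalised (vocabulary of `GraphAutomorphismsOneForms`: `edgePull σ K α = α^*`,
## `orientSign`; of `FundamentalCyclesCuts`: `fundCycleVec`, `fundCycleBasis`; `K` an ordered field)

* §1 `flowRep σ K α = (α⁻¹)^*|_{flow space}` (a homomorphism in `α`: `flowRep_one`, `flowRep_mul`);
  `fundCycleBasis_repr_apply` (coordinates in the fundamental-cycle basis = chord values);
  `cycleMatrix σ K hTG hT α` = the matrix of `(α⁻¹)^*` in that basis, its entries
  `ε_{α⁻¹}(i) · ξ_(T,j)(α⁻¹ i) ∈ {0, 1, −1}` (`cycleMatrix_apply`, `cycleMatrix_apply_mem`),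
  multiplicativity, and `cycleMatrix α = 1 ⇒ α = 1` (Proposition 36);
* §2 over `ℤ`: `intCycleMatrix` (the same matrix with integer entries), the homomorphisms
  `intCycleRep : Aut(G) →* M_g(ℤ)` and **`cycleRepGL : Aut(G) →* GL(chords of T, ℤ)`**, injective
  for a 2-edge-connected graph of genus `≥ 2` (`cycleRepGL_injective`), and **Corollary 38**
  `exists_monoidHom_GL_injective` (`∃ ρ : Aut(G) →* GL(Fin g, ℤ)` injective, `g = corank G`) /
  `exists_monoidHom_GL_genus_injective` (`g = (genus G).toNat`);
* §3 «preserves the lattice `H¹(G, ℤ)`»: `edgePull_mem_intFlowLattice` (the tree's `intFlowLattice`).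

Definitions with bodies and theorems; no `sorry`; no named facts; no instances.
-/

open Finset SimpleGraph Matrix
open Literature.Combinatorics.SimpleGraph.ChipFiring
open Literature.Combinatorics.SimpleGraph.OrientedIncidence
open Literature.Combinatorics.SimpleGraph.ElementaryGraphSachs

namespace Literature.Combinatorics.SimpleGraph.BakerNorine

variable {V : Type*} [Fintype V] [DecidableEq V] {G : SimpleGraph V} [DecidableRel G.Adj]
variable (σ : Orientation G) (K : Type*) [Field K] [LinearOrder K] [IsStrictOrderedRing K]

section Cor38

variable {T : SimpleGraph V} [DecidableRel T.Adj]

/-! ### §1 The representation `α ↦ (α⁻¹)^*` on the flow space and its matrix in the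
fundamental-cycle basis -/

/-- The (covariant) representation of `Aut(G)` on the flow space: `α ↦ (α⁻¹)^*|_{ker D}`. [cite:
BakerNorine2009, Corollary 38 (proof: «`Aut(G)` acts faithfully on the `g`-dimensional vector space
`H¹(G, ℝ)`»)] -/
noncomputable def flowRep (α : G ≃g G) : σ.flowSpace K →ₗ[K] σ.flowSpace K :=
  (edgePull σ K α⁻¹).restrict (mapsTo_edgePull_flowSpace σ K α⁻¹)

omit [LinearOrder K] [IsStrictOrderedRing K] in
/-- Unfolding `flowRep`. [cite: BakerNorine2009, Corollary 38 (proof)] -/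
@[simp] theorem coe_flowRep_apply (α : G ≃g G) (z : σ.flowSpace K) :
    (flowRep σ K α z : G.edgeSet → K) = edgePull σ K α⁻¹ z := rfl

omit [LinearOrder K] [IsStrictOrderedRing K] in
/-- `flowRep 1 = id`. [cite: BakerNorine2009, Corollary 38 (proof)] -/
theorem flowRep_one : flowRep σ K (1 : G ≃g G) = LinearMap.id := by
  refine LinearMap.ext fun z => Subtype.ext ?_
  rw [coe_flowRep_apply, inv_one, edgePull_one, LinearMap.id_apply, LinearMap.id_apply]

omit [LinearOrder K] [IsStrictOrderedRing K] in
/-- `flowRep (αβ) = flowRep α ∘ flowRep β` (a homomorphism: `((αβ)⁻¹)^* = (β⁻¹α⁻¹)^* =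
(α⁻¹)^*(β⁻¹)^*`). [cite: BakerNorine2009, Corollary 38 (proof)] -/
theorem flowRep_mul (α β : G ≃g G) : flowRep σ K (α * β) = flowRep σ K α ∘ₗ flowRep σ K β := by
  refine LinearMap.ext fun z => Subtype.ext ?_
  rw [LinearMap.comp_apply, coe_flowRep_apply, coe_flowRep_apply, coe_flowRep_apply,
    _root_.mul_inv_rev, edgePull_mul, LinearMap.comp_apply]

omit [LinearOrder K] [IsStrictOrderedRing K] in
/-- **Coordinates in the fundamental-cycle basis are the chord values**: for a flow `z` and a chord
`e` of the spanning tree `T`, the `ξ_(T,e)`-coordinate of `z` is `z(e)` (`ξ_(T,e)(e) = 1` and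
`ξ_(T,e′)(e) = 0` for the other chords). [cite: Biggs1974, Theorem 5.2 (1) (proof); GodsilRoyle2001,
§14.2] -/
theorem fundCycleBasis_repr_apply (hTG : T ≤ G) (hT : T.IsTree) (z : σ.flowSpace K)
    (i : {e : G.edgeSet // (e : Sym2 V) ∉ T.edgeSet}) :
    (σ.fundCycleBasis K hTG hT).repr z i = (z : G.edgeSet → K) i := by
  set b := σ.fundCycleBasis K hTG hT
  have h := congr_arg (fun w : σ.flowSpace K => (w : G.edgeSet → K) (i : G.edgeSet)) (b.sum_repr z)
  simp only [Submodule.coe_sum, Submodule.coe_smul, Finset.sum_apply, Pi.smul_apply, smul_eq_mul] at h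
  rw [← h, Finset.sum_eq_single i]
  · rw [σ.coe_fundCycleBasis K hTG hT, σ.fundCycleVec_apply_self K hTG hT.connected i.2, mul_one]
  · intro j _ hji
    rw [σ.coe_fundCycleBasis K hTG hT, σ.fundCycleVec_apply_of_not_mem K hTG hT.connected i.2
      (fun h => hji (Subtype.ext h).symm), mul_zero]
  · exact fun h => absurd (Finset.mem_univ i) h

/-- **The matrix of `(α⁻¹)^*` in the fundamental-cycle basis** of a spanning tree `T` (rows and
columns indexed by the chords of `T`). [cite: BakerNorine2009, Corollary 38 (proof: «and preserves
the lattice `H¹(G, ℤ)`»)] -/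
noncomputable def cycleMatrix (hTG : T ≤ G) (hT : T.IsTree) (α : G ≃g G) :
    Matrix {e : G.edgeSet // (e : Sym2 V) ∉ T.edgeSet} {e : G.edgeSet // (e : Sym2 V) ∉ T.edgeSet} K :=
  LinearMap.toMatrix (σ.fundCycleBasis K hTG hT) (σ.fundCycleBasis K hTG hT) (flowRep σ K α)

omit [LinearOrder K] [IsStrictOrderedRing K] in
/-- **The entries of the matrix of `(α⁻¹)^*`**: `M(α)_{ij} = ε_{α⁻¹}(i) · ξ_(T,j)(α⁻¹ i)`. [cite:
BakerNorine2009, Corollary 38 (proof)] -/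
theorem cycleMatrix_apply (hTG : T ≤ G) (hT : T.IsTree) (α : G ≃g G)
    (i j : {e : G.edgeSet // (e : Sym2 V) ∉ T.edgeSet}) :
    cycleMatrix σ K hTG hT α i j =
      orientSign σ K α⁻¹ i * σ.fundCycleVec K hTG hT.connected j (α⁻¹.mapEdgeSet i) := by
  rw [cycleMatrix, LinearMap.toMatrix_apply, fundCycleBasis_repr_apply, coe_flowRep_apply,
    edgePull_apply, σ.coe_fundCycleBasis K hTG hT]

omit [LinearOrder K] [IsStrictOrderedRing K] in
/-- The entries of `M(α)` lie in `{0, 1, −1}`. [cite: BakerNorine2009, Corollary 38 (proof: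
«preserves the lattice `H¹(G, ℤ)`»)] -/
theorem cycleMatrix_apply_mem (hTG : T ≤ G) (hT : T.IsTree) (α : G ≃g G)
    (i j : {e : G.edgeSet // (e : Sym2 V) ∉ T.edgeSet}) :
    cycleMatrix σ K hTG hT α i j = 0 ∨ cycleMatrix σ K hTG hT α i j = 1 ∨
      cycleMatrix σ K hTG hT α i j = -1 := by
  rw [cycleMatrix_apply]
  rcases σ.fundCycleVec_apply_mem K hTG hT.connected j.2 (α⁻¹.mapEdgeSet i) with h | h | h <;>
    rw [h] <;> unfold orientSign <;> split_ifs <;> norm_num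

omit [LinearOrder K] [IsStrictOrderedRing K] in
/-- `M(1) = 1`. [cite: BakerNorine2009, Corollary 38 (proof)] -/
theorem cycleMatrix_one (hTG : T ≤ G) (hT : T.IsTree) : cycleMatrix σ K hTG hT (1 : G ≃g G) = 1 := by
  rw [cycleMatrix, flowRep_one, LinearMap.toMatrix_id]

omit [LinearOrder K] [IsStrictOrderedRing K] in
/-- `M(αβ) = M(α) M(β)`. [cite: BakerNorine2009, Corollary 38 (proof)] -/
theorem cycleMatrix_mul (hTG : T ≤ G) (hT : T.IsTree) (α β : G ≃g G) :
    cycleMatrix σ K hTG hT (α * β) = cycleMatrix σ K hTG hT α * cycleMatrix σ K hTG hT β := by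
  rw [cycleMatrix, flowRep_mul, LinearMap.toMatrix_comp _ (σ.fundCycleBasis K hTG hT)]
  rfl

/-- `M(α) = 1` forces `α = 1` (Proposition 36). [cite: BakerNorine2009, Corollary 38 (proof: «acts
faithfully»), Proposition 36] -/
theorem eq_one_of_cycleMatrix_eq_one (h2 : G.IsEdgeConnected 2) (hg : 2 ≤ genus G) (hTG : T ≤ G)
    (hT : T.IsTree) {α : G ≃g G} (h : cycleMatrix σ K hTG hT α = 1) : α = 1 := by
  rw [cycleMatrix, ← LinearMap.toMatrix_id (σ.fundCycleBasis K hTG hT)] at h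
  have hid := (LinearMap.toMatrix _ _).injective h
  have h1 : α⁻¹ = 1 :=
    eq_one_of_edgePull_eq_self σ K h2 hg α⁻¹ fun x hx => by
      have := congr_arg (fun f => ((f ⟨x, hx⟩ : σ.flowSpace K) : G.edgeSet → K)) hid
      simpa only [coe_flowRep_apply, LinearMap.id_apply] using this
  exact inv_eq_one.1 h1

/-! ### §2 Over `ℤ`: `Aut(G) → GL(g, ℤ)` -/

/-- The integer matrix underlying a rational matrix with integer entries. [folklore] -/
private def numMatrix {m : Type*} (M : Matrix m m ℚ) : Matrix m m ℤ := M.map Rat.num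

/-- A rational matrix with integer entries is the cast of its `numMatrix`. [folklore] -/
private theorem map_numMatrix {m : Type*} (M : Matrix m m ℚ) (h : ∀ i j, ∃ z : ℤ, M i j = z) :
    (numMatrix M).map (Int.cast : ℤ → ℚ) = M := by
  ext i j
  obtain ⟨z, hz⟩ := h i j
  rw [Matrix.map_apply, numMatrix, Matrix.map_apply, hz, Rat.num_intCast]

/-- **The matrix of `(α⁻¹)^*` on `H¹(G, ℤ)` in the fundamental-cycle basis**, an integer matrix
(`Aut(G)` «preserves the lattice `H¹(G, ℤ)`»; the fundamental cycles of a spanning tree are a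
`ℤ`-basis of the integer flows). [cite: BakerNorine2009, Corollary 38 (proof); Biggs1974, Theorem
5.2 (1)] -/
noncomputable def intCycleMatrix (hTG : T ≤ G) (hT : T.IsTree) (α : G ≃g G) :
    Matrix {e : G.edgeSet // (e : Sym2 V) ∉ T.edgeSet} {e : G.edgeSet // (e : Sym2 V) ∉ T.edgeSet} ℤ :=
  numMatrix (cycleMatrix σ ℚ hTG hT α)

/-- `M_ℤ(α)` cast to `ℚ` is `M(α)`. [cite: BakerNorine2009, Corollary 38 (proof)] -/
theorem mapMatrix_intCycleMatrix (hTG : T ≤ G) (hT : T.IsTree) (α : G ≃g G) :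
    (Int.castRingHom ℚ).mapMatrix (intCycleMatrix σ hTG hT α) = cycleMatrix σ ℚ hTG hT α := by
  rw [RingHom.mapMatrix_apply, Int.coe_castRingHom]
  refine map_numMatrix _ fun i j => ?_
  rcases cycleMatrix_apply_mem σ ℚ hTG hT α i j with h | h | h
  · exact ⟨0, by rw [h, Int.cast_zero]⟩
  · exact ⟨1, by rw [h, Int.cast_one]⟩
  · exact ⟨-1, by rw [h, Int.cast_neg, Int.cast_one]⟩

omit [Fintype V] [DecidableEq V] [DecidableRel G.Adj] [DecidableRel T.Adj] in
/-- `M ↦ M.map (ℤ → ℚ)` is injective. [folklore] -/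
private theorem mapMatrix_int_injective {m : Type*} [Fintype m] [DecidableEq m] :
    Function.Injective ((Int.castRingHom ℚ).mapMatrix : Matrix m m ℤ → Matrix m m ℚ) :=
  fun M N h => Matrix.map_injective (f := (Int.cast : ℤ → ℚ)) Int.cast_injective
    (by simpa only [RingHom.mapMatrix_apply, Int.coe_castRingHom] using h)

/-- **`α ↦ M_ℤ(α)` is a monoid homomorphism `Aut(G) → M_g(ℤ)`.** [cite: BakerNorine2009, Corollary
38 (proof)] -/
noncomputable def intCycleRep (hTG : T ≤ G) (hT : T.IsTree) :
    (G ≃g G) →* Matrix {e : G.edgeSet // (e : Sym2 V) ∉ T.edgeSet}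
      {e : G.edgeSet // (e : Sym2 V) ∉ T.edgeSet} ℤ where
  toFun := intCycleMatrix σ hTG hT
  map_one' := mapMatrix_int_injective (by
    rw [mapMatrix_intCycleMatrix, map_one, cycleMatrix_one])
  map_mul' α β := mapMatrix_int_injective (by
    rw [mapMatrix_intCycleMatrix, map_mul, mapMatrix_intCycleMatrix, mapMatrix_intCycleMatrix,
      cycleMatrix_mul])

/-- Unfolding `intCycleRep`. [cite: BakerNorine2009, Corollary 38 (proof)] -/
@[simp] theorem intCycleRep_apply (hTG : T ≤ G) (hT : T.IsTree) (α : G ≃g G) :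
    intCycleRep σ hTG hT α = intCycleMatrix σ hTG hT α := rfl

/-- **The representation `Aut(G) → GL(𝓗¹(G, ℤ)) ≅ GL(chords, ℤ)`.** [cite: BakerNorine2009,
Corollary 38] -/
noncomputable def cycleRepGL (hTG : T ≤ G) (hT : T.IsTree) :
    (G ≃g G) →* GL {e : G.edgeSet // (e : Sym2 V) ∉ T.edgeSet} ℤ :=
  (intCycleRep σ hTG hT).toHomUnits

/-- Unfolding `cycleRepGL`. [cite: BakerNorine2009, Corollary 38] -/
@[simp] theorem coe_cycleRepGL_apply (hTG : T ≤ G) (hT : T.IsTree) (α : G ≃g G) :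
    ((cycleRepGL σ hTG hT α : GL _ ℤ) : Matrix _ _ ℤ) = intCycleMatrix σ hTG hT α := rfl

/-- **The representation on `H¹(G, ℤ)` is faithful** (2-edge-connected, genus `≥ 2`). [cite:
BakerNorine2009, Corollary 38 (proof: «Since `Aut(G)` acts faithfully […] and preserves the lattice
`H¹(G, ℤ)`, the result follows»)] -/
theorem cycleRepGL_injective (h2 : G.IsEdgeConnected 2) (hg : 2 ≤ genus G) (hTG : T ≤ G)
    (hT : T.IsTree) : Function.Injective (cycleRepGL σ hTG hT) := by
  rw [injective_iff_map_eq_one]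
  intro α hα
  refine eq_one_of_cycleMatrix_eq_one σ ℚ h2 hg hTG hT ?_
  rw [← mapMatrix_intCycleMatrix, ← coe_cycleRepGL_apply, hα, Units.val_one, map_one]

/-- A spanning tree of a connected graph has `g = m − n + 1` chords (the co-rank). [cite: Biggs1974,
Theorem 5.2 (1) («the `m − n + 1` elements `ξ_(T,g)`»)] -/
theorem card_chords_eq_corank (hTG : T ≤ G) (hT : T.IsTree) :
    Fintype.card {e : G.edgeSet // (e : Sym2 V) ∉ T.edgeSet} = corank G := by
  rw [← (someOrientation G).finrank_flowSpace_eq_card_chords ℚ hTG hT,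
    (someOrientation G).finrank_flowSpace ℚ]

/-- **Corollary 38** (Baker–Norine): «If `G` is a 2-edge-connected graph of genus `g ≥ 2`, then the
group `Aut(G)` is isomorphic to a subgroup of the group `GL(g, ℤ)` of invertible `g × g` matrices
with coefficients in `ℤ`» — an injective homomorphism `Aut(G) → GL(g, ℤ)`, `g = m − n + 1` the
co-rank (`= genus G`, `genus_eq_corank`). [cite: BakerNorine2009, Corollary 38] -/
theorem exists_monoidHom_GL_injective (h2 : G.IsEdgeConnected 2) (hg : 2 ≤ genus G) :
    ∃ ρ : (G ≃g G) →* GL (Fin (corank G)) ℤ, Function.Injective ρ := by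
  classical
  haveI : Nontrivial V := nontrivial_of_two_le_genus hg
  have hG : G.Connected := h2.connected (by norm_num)
  obtain ⟨T, hTG, hT⟩ := hG.exists_isTree_le
  set σ := someOrientation G
  let e : {e : G.edgeSet // (e : Sym2 V) ∉ T.edgeSet} ≃ Fin (corank G) :=
    Fintype.equivFinOfCardEq (card_chords_eq_corank hTG hT)
  let r : Matrix {e : G.edgeSet // (e : Sym2 V) ∉ T.edgeSet} {e : G.edgeSet // (e : Sym2 V) ∉ T.edgeSet} ℤ
      →* Matrix (Fin (corank G)) (Fin (corank G)) ℤ :=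
    (Matrix.reindexAlgEquiv ℤ ℤ e).toMonoidHom
  have hr : Function.Injective r := (Matrix.reindexAlgEquiv ℤ ℤ e).injective
  refine ⟨(Units.map r).comp (cycleRepGL σ hTG hT), ?_⟩
  exact (Units.map_injective hr).comp (cycleRepGL_injective σ h2 hg hTG hT)

/-- **Corollary 38 with `g` the genus** (`genus G = corank G` for a connected graph). [cite:
BakerNorine2009, Corollary 38] -/
theorem exists_monoidHom_GL_genus_injective (h2 : G.IsEdgeConnected 2) (hg : 2 ≤ genus G) :
    ∃ ρ : (G ≃g G) →* GL (Fin (genus G).toNat) ℤ, Function.Injective ρ := by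
  haveI : Nontrivial V := nontrivial_of_two_le_genus hg
  have hG : G.Connected := h2.connected (by norm_num)
  have h : (genus G).toNat = corank G := by rw [genus_eq_corank hG, Int.toNat_natCast]
  rw [h]
  exact exists_monoidHom_GL_injective h2 hg

/-! ### §3 `α^*` preserves the lattice `H¹(G, ℤ)` of integer flows -/

/-- **«`Aut(G)` […] preserves the lattice `H¹(G, ℤ)`»**: `α^*` maps integer flows to integer flows
(the tree's `intFlowLattice`). [cite: BakerNorine2009, Corollary 38 (proof)] -/
theorem edgePull_mem_intFlowLattice (α : G ≃g G) {x : G.edgeSet → K}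
    (hx : x ∈ σ.intFlowLattice K) : edgePull σ K α x ∈ σ.intFlowLattice K := by
  rw [σ.mem_intFlowLattice_iff K] at hx ⊢
  obtain ⟨f, hf, rfl⟩ := hx
  classical
  let f' : G.edgeSet → ℤ := fun e =>
    (if σ.head (α.mapEdgeSet e) = α (σ.head e) then 1 else -1) * f (α.mapEdgeSet e)
  have hcast : Orientation.castVec K f' = edgePull σ K α (Orientation.castVec K f) := by
    funext e
    rw [Orientation.castVec_apply, edgePull_apply, Orientation.castVec_apply]
    simp only [f', Int.cast_mul, orientSign]
    split_ifs <;> simp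
  refine ⟨f', ?_, hcast⟩
  rw [← σ.castVec_mem_flowSpace_iff K, hcast]
  exact edgePull_mem_flowSpace σ K α ((σ.castVec_mem_flowSpace_iff K f).2 hf)

end Cor38

end Literature.Combinatorics.SimpleGraph.BakerNorine

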